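import Summits.QuantumFields.YangMills.Theorems.BalabanUVNodesN15PerCubeGreenSopLetters
import HarnessLib

/-!
# N15 = NE2, road (c) — PROGRAMME (PC), towards (PC-B): the NEAR and FAR staircase letters of `cvT e U` for the site coarse kit — rows and columns of `T(Γ_{y,a}) − 1` on a block whose
# sites carry the trivial-gauge (3.35) datum (`≤ (1 + ηr_V)^{(d+1)n} − 1`), and everywhere (`≤ |ι| + 1`) (dag-n15-c g27, n15-c∕298b-letters)

Cell `pub-ymgap`, seat `pub-ymgap-dag-n15-c` (generation g27; R134 (a), s1; HUMAN RULING D-0062).  `bears_on: R4∕N15 · K3⁸ SpineGivenEndpointR13SepCoPHV (stmt-QuantumFields-27366)`;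
filed `--kind proof --supports stmt-QuantumFields-27366 --as helper` — COUNT-NEUTRAL.  0 `def`, 0 `sorry`.  Imports n15-c∕298a `…PerCubeGreenSopLetters` (through it: n15-c∕182
`rows/cols_mprod_sub_one_le`, n15-c∕265 `rows_cvaStair_sub_one_le_of_blockOf`'s pattern, dag-n15-w2 `uN_opLetters_of_gauge335`, `uN_abs_coordMat_conj_sub_one_entry_le_op`, `cvaStair_one`).

HONEST FRAMING ∕ LIMITS.  Letters only; MODEL carriers; NE2⁺ NOT PRINTED, NOT proved; K3⁸ OPEN; counts UNMOVED.  Restate-immune (no Theses import).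
-/

set_option autoImplicit false

noncomputable section
open scoped BigOperators Matrix Matrix.Norms.L2Operator
open Finset

namespace Summit.QuantumFields.YangMills.BalabanUVNodes.N15.Gluing

open Literature.MathematicalPhysics.QuantumFieldTheory.Balaban1983to89
open Literature.MathematicalPhysics.QuantumFieldTheory.Balaban1983to89.B5Prop11Plancherel (Tor fine)
open Literature.MathematicalPhysics.QuantumFieldTheory.Balaban1983to89.B9Eq3117Current (gaugeTr gaugeTr_apply)
open Literature.MathematicalPhysics.QuantumFieldTheory.Balaban1983to89.B9Eq39Adjoint (covD fluct)
open Literature.MathematicalPhysics.QuantumFieldTheory.King1986.Torus (blockOf)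
open Literature.Barriers.QuantumFields (traceForm)
open Summit.QuantumFields.YangMills.BalabanUVNodes.N15.MatrixSpecies (coordMat basisConst basisConst_nonneg)
open Summit.QuantumFields.YangMills.BalabanUVNodes.N15.CovAvg (cvaStair cvaStair_one cvaLeg mprod rows_mprod_sub_one_le cols_mprod_sub_one_le)
open Summit.QuantumFields.YangMills.BalabanUVNodes.N15.DefectKernel (kingBlockOf_bpt)
open Summit.QuantumFields.YangMills.BalabanUVNodes.N15.CurvedSpecies (uN_opLetters_of_gauge335 uN_abs_coordMat_conj_sub_one_entry_le_op)

section Letters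

variable {d L : ℕ} [NeZero L] {mv kk : ℕ} {hL : Odd L ∧ 1 < L} (ι : Type) [Fintype ι] [DecidableEq ι] {mm : Type} [Fintype mm] [DecidableEq mm] [Nonempty mm]
  (e : Matrix mm mm ℂ ≃L[ℝ] (ι → ℝ))

omit [Nonempty mm] in
/-- COLUMNS twin of n15-c∕265 `rows_cvaStair_sub_one_le_of_blockOf`: the staircase of block `y` reads bonds of block `y` only. [cite: Balaban1985Averaging, (125)–(126) p.36 (shape)] -/
theorem cols_cvaStair_sub_one_le_of_blockOf {T : Fin (d + 1) → ScX d L mv kk hL → Matrix ι ι ℝ} {ρ : ℝ} (hρ : 0 ≤ ρ) (y : Tor (cvM d L mv kk hL))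
    (hT : ∀ μ x, blockOf (L ^ kk) (cvM d L mv kk hL) x = y → ∀ j, ∑ i, |(T μ x - 1) i j| ≤ ρ) (a : Fin (d + 1) → Fin (L ^ kk)) (ν : Fin (d + 1)) (j : ι) :
    ∑ i, |(cvaStair (cvM d L mv kk hL) (L ^ kk) (fun μ b => T μ b.1) y a ν - 1) i j| ≤ (1 + ρ) ^ ((d + 1) * L ^ kk) - 1 := by
  have hρ₁ : 0 ≤ (1 + ρ) ^ (L ^ kk) - 1 := by have := one_le_pow₀ (M₀ := ℝ) (a := 1 + ρ) (by linarith) (n := L ^ kk); linarith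
  have hleg : ∀ t < d + 1, ∀ j, ∑ i, |((if h : t < d + 1 then cvaLeg (cvM d L mv kk hL) (L ^ kk) (fun μ b => T μ b.1) y a ⟨t, h⟩ ν else 1) - 1) i j| ≤ (1 + ρ) ^ (L ^ kk) - 1 := by
    intro t ht j
    rw [dif_pos ht, cvaLeg]
    exact (cols_mprod_sub_one_le hρ (fun s _ j' => hT _ _ (kingBlockOf_bpt _ _ _ _) j') j).trans (T4AxialChain.pow_sub_one_mono hρ (a ⟨t, ht⟩).isLt.le)
  refine (cols_mprod_sub_one_le hρ₁ hleg j).trans (le_of_eq ?_)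
  rw [add_sub_cancel, ← pow_mul, mul_comm]

/-- ★ THE SITE LETTER OF `cvT e U − 1` FROM THE TRIVIAL-GAUGE (3.35) DATUM: on a set `Q` where `U = e^{iηA}` (gauge `1`), `‖A‖ < Cξ⁻¹`, `‖η⁻¹D¹A‖ < Cξ⁻²`, every row and every column of
`coordMat e (Ad_{U_μ(x)}) − 1` at `x ∈ Q` is `≤ |ι|·κ_e·2√|m|·√|m|·η(C∕ξ)e^{ηC∕ξ}` (dag-n15-w2's operator letter and entry letter). [cite: Balaban1985BackgroundPropagators, (3.35) p.396] -/
theorem rows_cols_cvT_sub_one_le_of_datum {X J : Type} [Fintype X] [Fintype J] (τ : J → X ≃ X)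
    {U : J → X → (Matrix mm mm ℂ)ˣ} (hU : ∀ μ x, (U μ x : Matrix mm mm ℂ) ∈ Matrix.unitaryGroup mm ℂ) {η : ℝ} (hη : 0 < η) {Q : Set X} {ξ C : ℝ} {A : J → X → Matrix mm mm ℂ}
    (hg : ∀ μ, ∀ z ∈ Q, gaugeTr τ (fun _ => (1 : (Matrix mm mm ℂ)ˣ)) U μ z = fluct η A μ z) (hA : ∀ μ, ∀ z ∈ Q, ‖A μ z‖ < C * ξ⁻¹)
    (hD : ∀ μ ν, ∀ z ∈ Q, ‖((η : ℂ)⁻¹) • covD τ (fun _ _ => (1 : (Matrix mm mm ℂ)ˣ)) μ (A ν) z‖ < C * (ξ ^ 2)⁻¹) {x : X} (hx : x ∈ Q) (μ : J) :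
    (∀ i, ∑ j, |(coordMat e (ContinuousLinearMap.mulLeftRight ℝ (Matrix mm mm ℂ) (U μ x : Matrix mm mm ℂ) (U μ x : Matrix mm mm ℂ)ᴴ) - 1) i j| ≤
        Fintype.card ι * (@basisConst ι _ (Matrix mm mm ℂ) Matrix.frobeniusNormedAddCommGroup Matrix.frobeniusNormedSpace e * (2 * Real.sqrt (Fintype.card mm)) *
          (Real.sqrt (Fintype.card mm) * (η * (C / ξ) * Real.exp (η * (C / ξ)))))) ∧
      ∀ j, ∑ i, |(coordMat e (ContinuousLinearMap.mulLeftRight ℝ (Matrix mm mm ℂ) (U μ x : Matrix mm mm ℂ) (U μ x : Matrix mm mm ℂ)ᴴ) - 1) i j| ≤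
        Fintype.card ι * (@basisConst ι _ (Matrix mm mm ℂ) Matrix.frobeniusNormedAddCommGroup Matrix.frobeniusNormedSpace e * (2 * Real.sqrt (Fintype.card mm)) *
          (Real.sqrt (Fintype.card mm) * (η * (C / ξ) * Real.exp (η * (C / ξ))))) := by
  have hone : ∀ z ∈ Q, ‖(((fun (_ : X) => (1 : (Matrix mm mm ℂ)ˣ)) z : (Matrix mm mm ℂ)ˣ) : Matrix mm mm ℂ)‖ ≤ 1 ∧
      ‖((((fun (_ : X) => (1 : (Matrix mm mm ℂ)ˣ)) z)⁻¹ : (Matrix mm mm ℂ)ˣ) : Matrix mm mm ℂ)‖ ≤ 1 :=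
    fun z _ => by simp only [Units.val_one, inv_one]; exact ⟨norm_one.le, norm_one.le⟩
  obtain ⟨-, h1, -⟩ := uN_opLetters_of_gauge335 (T := τ) U hη hone hg hA hD
  have hnorm : ‖(U μ x : Matrix mm mm ℂ) - 1‖ ≤ η * (C / ξ) * Real.exp (η * (C / ξ)) := by
    have h := h1 μ x hx
    rwa [gaugeTr_apply, Units.val_mul, Units.val_mul, Units.val_one, inv_one, Units.val_one, one_mul, mul_one] at h
  have hU' : ((U μ x : Matrix mm mm ℂ))ᴴ * (U μ x : Matrix mm mm ℂ) = 1 := Matrix.mem_unitaryGroup_iff'.mp (hU μ x)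
  have hkk := @basisConst_nonneg ι _ (Matrix mm mm ℂ) Matrix.frobeniusNormedAddCommGroup Matrix.frobeniusNormedSpace e
  have hentry : ∀ i j, |(coordMat e (ContinuousLinearMap.mulLeftRight ℝ (Matrix mm mm ℂ) (U μ x : Matrix mm mm ℂ) (U μ x : Matrix mm mm ℂ)ᴴ) - 1) i j| ≤
      @basisConst ι _ (Matrix mm mm ℂ) Matrix.frobeniusNormedAddCommGroup Matrix.frobeniusNormedSpace e * (2 * Real.sqrt (Fintype.card mm)) *
        (Real.sqrt (Fintype.card mm) * (η * (C / ξ) * Real.exp (η * (C / ξ)))) := fun i j =>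
    (uN_abs_coordMat_conj_sub_one_entry_le_op e hU' i j).trans (by gcongr)
  refine ⟨fun i => ?_, fun j => ?_⟩
  · calc ∑ j, |(coordMat e (ContinuousLinearMap.mulLeftRight ℝ (Matrix mm mm ℂ) (U μ x : Matrix mm mm ℂ) (U μ x : Matrix mm mm ℂ)ᴴ) - 1) i j|
        ≤ ∑ _j : ι, @basisConst ι _ (Matrix mm mm ℂ) Matrix.frobeniusNormedAddCommGroup Matrix.frobeniusNormedSpace e * (2 * Real.sqrt (Fintype.card mm)) *
            (Real.sqrt (Fintype.card mm) * (η * (C / ξ) * Real.exp (η * (C / ξ)))) := Finset.sum_le_sum fun j _ => hentry i j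
      _ = _ := by rw [Finset.sum_const, Finset.card_univ, nsmul_eq_mul]
  · calc ∑ i, |(coordMat e (ContinuousLinearMap.mulLeftRight ℝ (Matrix mm mm ℂ) (U μ x : Matrix mm mm ℂ) (U μ x : Matrix mm mm ℂ)ᴴ) - 1) i j|
        ≤ ∑ _i : ι, @basisConst ι _ (Matrix mm mm ℂ) Matrix.frobeniusNormedAddCommGroup Matrix.frobeniusNormedSpace e * (2 * Real.sqrt (Fintype.card mm)) *
            (Real.sqrt (Fintype.card mm) * (η * (C / ξ) * Real.exp (η * (C / ξ)))) := Finset.sum_le_sum fun i _ => hentry i j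
      _ = _ := by rw [Finset.sum_const, Finset.card_univ, nsmul_eq_mul]

omit [Nonempty mm] in
/-- ★ THE FAR LETTER: rows and columns of `T(Γ) − 1(Γ) = T(Γ) − 1` for `T = cvT e U`, `U` unitary, are `≤ |ι| + 1` (n15-c∕298a: `T(Γ)` orthogonal; `1(Γ) = 1`). [folklore] -/
theorem rows_cols_cvaStair_cvT_sub_one_le (he : ∀ A B : Matrix mm mm ℂ, traceForm A B = e A ⬝ᵥ e B) {U : Fin (d + 1) → ScX d L mv kk hL → Matrix mm mm ℂ} (hU : ∀ μ x, (U μ x)ᴴ * U μ x = 1)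
    (y : Tor (cvM d L mv kk hL)) (a : Fin (d + 1) → Fin (L ^ kk)) (ν : Fin (d + 1)) :
    (∀ i, ∑ j, |(cvaStair (cvM d L mv kk hL) (L ^ kk) (fun μ b => cvT e U μ b.1) y a ν -
        cvaStair (cvM d L mv kk hL) (L ^ kk) (fun μ b => (fun (_ : Fin (d + 1)) (_ : ScX d L mv kk hL) => (1 : Matrix ι ι ℝ)) μ b.1) y a ν) i j| ≤ Fintype.card ι + 1) ∧
      ∀ j, ∑ i, |(cvaStair (cvM d L mv kk hL) (L ^ kk) (fun μ b => cvT e U μ b.1) y a ν -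
        cvaStair (cvM d L mv kk hL) (L ^ kk) (fun μ b => (fun (_ : Fin (d + 1)) (_ : ScX d L mv kk hL) => (1 : Matrix ι ι ℝ)) μ b.1) y a ν) i j| ≤ Fintype.card ι + 1 := by
  have h1 : cvaStair (cvM d L mv kk hL) (L ^ kk) (fun μ b => (fun (_ : Fin (d + 1)) (_ : ScX d L mv kk hL) => (1 : Matrix ι ι ℝ)) μ b.1) y a ν = 1 := cvaStair_one _ _ y a ν
  rw [h1]
  refine ⟨fun i => ?_, fun j => ?_⟩
  · calc ∑ j, |(cvaStair (cvM d L mv kk hL) (L ^ kk) (fun μ b => cvT e U μ b.1) y a ν - 1) i j|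
        ≤ ∑ j, (|cvaStair (cvM d L mv kk hL) (L ^ kk) (fun μ b => cvT e U μ b.1) y a ν i j| + |(1 : Matrix ι ι ℝ) i j|) :=
          Finset.sum_le_sum fun j _ => by rw [Matrix.sub_apply]; exact abs_sub _ _
      _ = ∑ j, |cvaStair (cvM d L mv kk hL) (L ^ kk) (fun μ b => cvT e U μ b.1) y a ν i j| + ∑ j, |(1 : Matrix ι ι ℝ) i j| := Finset.sum_add_distrib
      _ ≤ Fintype.card ι + 1 := by
          refine add_le_add (rows_cvaStair_cvT_le (cvM d L mv kk hL) (L ^ kk) e he hU y a ν i) (le_of_eq ?_)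
          simp only [Matrix.one_apply, apply_ite abs, abs_one, abs_zero, Finset.sum_ite_eq, Finset.mem_univ, if_true]
  · calc ∑ i, |(cvaStair (cvM d L mv kk hL) (L ^ kk) (fun μ b => cvT e U μ b.1) y a ν - 1) i j|
        ≤ ∑ i, (|cvaStair (cvM d L mv kk hL) (L ^ kk) (fun μ b => cvT e U μ b.1) y a ν i j| + |(1 : Matrix ι ι ℝ) i j|) :=
          Finset.sum_le_sum fun i _ => by rw [Matrix.sub_apply]; exact abs_sub _ _
      _ = ∑ i, |cvaStair (cvM d L mv kk hL) (L ^ kk) (fun μ b => cvT e U μ b.1) y a ν i j| + ∑ i, |(1 : Matrix ι ι ℝ) i j| := Finset.sum_add_distrib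
      _ ≤ Fintype.card ι + 1 := by
          refine add_le_add (cols_cvaStair_cvT_le (cvM d L mv kk hL) (L ^ kk) e he hU y a ν j) (le_of_eq ?_)
          simp only [Matrix.one_apply, apply_ite abs, abs_one, abs_zero, Finset.sum_ite_eq', Finset.mem_univ, if_true]

end Letters

end Summit.QuantumFields.YangMills.BalabanUVNodes.N15.Gluing

end
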